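import Mathlib.Analysis.SpecificLimits.Basic
import Mathlib.Analysis.Complex.Basic
import Literature.NumberTheory.DiophantineGeometry.FunctionFieldZetaLPolynomialProofs
import Literature.NumberTheory.DiophantineGeometry.FunctionFieldSchmidtDegreeOneConsequencesProofs
import HarnessLib

/-!
# The Hasse–Weil theorem from point-count estimates (Stichtenoth Lemma 5.2.4 + Lemma 5.2.5)

Sibling **proof file** (theorems only; D-0014/D-0026: no new facts) of `FunctionFieldZeta`, whose
named fact `hasseWeil` is **Stichtenoth Thm. 5.2.1** (the Riemann hypothesis for function fields
over finite fields, Weil 1948, in Bombieri's proof): the reciprocal roots `αᵢ` of `L_F(t)` satisfy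
`|αᵢ| = q^{1/2}`. This file proves the *reduction step* of Bombieri's proof as printed in
H. Stichtenoth, *Algebraic Function Fields and Codes*, 2nd ed. (GTM 254), §5.2, pp. 198–199
(held copy `book:stichtenothnd-algebraic-function-fields-codes`, text pp. 168–169):

* **Lemma 5.2.5**: if `|N_r - (q^r + 1)| ≤ c q^{r/2}` for all `r ≥ 1`, then Hasse–Weil holds for
  `F/𝔽_q`; combined with
* **Lemma 5.2.4**: Hasse–Weil holds for `F/𝔽_q` iff it holds for a constant field extension
  `F𝔽_{q^m}/𝔽_{q^m}` —

in the following constant-field-extension-free form, which is what the remaining steps of the proof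
(Prop. 5.2.6, the Stepanov–Bombieri upper bound, and the Galois-theoretic lower bound,
Prop. 5.2.7–5.2.8, both of which are only available after passing to `𝔽_{q^m}` with `q^m` a large
square) deliver:

* `hasseWeil_of_abs_pointCount_sub_le`: if for some `k ≥ 1` and `c` the point counts
  `N_r = ∑_{d ∣ r} d · B_d` (`pointCount`, eq. (5.40)) satisfy `|N_{ks} - (q^{ks} + 1)| ≤ c q^{ks/2}`
  for all `s ≥ 1`, then `hasseWeil 𝔽_q F`.

Proof as printed, with two deviations. (1) By Cor. 5.1.16 (`pointCount_eq_of_coe_eq_lSeries`,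
from Thm. 5.1.15 (a) = `lSeries_eq_polynomial_holds`, both in the tree)
`N_r - (q^r + 1) = -∑ᵢ αᵢ^r`, so the hypothesis bounds the power sums of `βᵢ := αᵢ^k` by
`c (q^{k/2})^s`; the book's Lemma 5.2.4 replaces `F` by `F_k` using `L_k(t) = ∏ (1 - αᵢ^k t)`
(Thm. 5.1.15 (f)); here the passage `αᵢ ↦ αᵢ^k` is made directly on the power sums, so no constant
field extension is needed. (2) The book bounds `|αᵢ|` through the radius of convergence of
`∑ᵢ βᵢt/(1 - βᵢt)`; here the same conclusion `|βᵢ| ≤ q^{k/2}` is obtained by an elementary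
mean-square argument (`PowerSum.norm_le_of_norm_sum_pow_le`: the `βᵢ` of maximal modulus `R` have
normalised power sums whose squares average to at least `1` over every long window, by summing the
geometric series `∑_s (uᵢū_j)^s`, so `‖∑ βᵢ^s‖ ≥ R^s/2 - n R₂^s` for arbitrarily large `s`). The end
of the proof is as printed: `∏ᵢ αᵢ = q^g` (the leading coefficient `a_{2g} = q^g`,
Thm. 5.1.15 (d), `coeff_two_mul_genus_lSeries`, with `a₀ = 1`) and `|αᵢ| ≤ q^{1/2}` for all `i`
force `|αᵢ| = q^{1/2}`.

## References

* H. Stichtenoth, *Algebraic Function Fields and Codes*, 2nd ed., GTM 254, Springer 2009, §5.2,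
  Lemma 5.2.4, Lemma 5.2.5, Thm. 5.1.15, Cor. 5.1.16. [Stichtenoth2009]
* E. Bombieri, *Counting points on curves over finite fields (d'après S. A. Stepanov)*,
  Sém. Bourbaki 430 (1973).
* A. Weil, *Sur les courbes algébriques et les variétés qui s'en déduisent*, Hermann 1948. [Weil1948]
-/

noncomputable section

open Finset Filter Topology
open scoped Classical Polynomial

namespace Literature.NumberTheory.DiophantineGeometry.AlgFunctionField

universe u v

/-! ### Power sums of complex numbers -/

namespace PowerSum

/-- A window of a geometric series on the unit circle is bounded by `2/|w - 1|`. [folklore] -/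
theorem norm_sum_range_pow_add_le {w : ℂ} (hw1 : ‖w‖ = 1) (hw : w ≠ 1) (N S : ℕ) :
    ‖∑ k ∈ range S, w ^ (N + k)‖ ≤ 2 / ‖w - 1‖ := by
  have hsum : ∑ k ∈ range S, w ^ (N + k) = w ^ N * ∑ k ∈ range S, w ^ k := by
    rw [mul_sum]
    exact sum_congr rfl fun k _ => pow_add w N k
  have hne : w - 1 ≠ 0 := sub_ne_zero.mpr hw
  rw [hsum, geom_sum_eq hw, norm_mul, norm_pow, hw1, one_pow, one_mul, norm_div]
  refine div_le_div_of_nonneg_right ?_ (norm_nonneg _)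
  calc ‖w ^ S - 1‖ ≤ ‖w ^ S‖ + ‖(1 : ℂ)‖ := norm_sub_le _ _
    _ = 2 := by rw [norm_pow, hw1, one_pow, norm_one]; norm_num

/-- `‖∑ u_i^s‖²` as a double sum `∑_{i,j} (u_i \bar u_j)^s`. [folklore] -/
theorem normSq_sum_pow_eq {ι : Type*} (I : Finset ι) (u : ι → ℂ) (s : ℕ) :
    ((‖∑ i ∈ I, u i ^ s‖ ^ 2 : ℝ) : ℂ) =
      ∑ i ∈ I, ∑ j ∈ I, (u i * (starRingEnd ℂ) (u j)) ^ s := by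
  rw [← Complex.normSq_eq_norm_sq, ← Complex.mul_conj, map_sum, sum_mul_sum]
  refine sum_congr rfl fun i _ => sum_congr rfl fun j _ => ?_
  rw [map_pow, mul_pow]

/-- The real part of a window sum of `w^s`, `|w| = 1`, is at least `S` if `w = 1` and at least
`-2/|w-1|` otherwise. [folklore] -/
theorem re_sum_range_pow_add_ge {w : ℂ} (hw1 : ‖w‖ = 1) (N S : ℕ) :
    (if w = 1 then (S : ℝ) else -(2 / ‖w - 1‖)) ≤ (∑ k ∈ range S, w ^ (N + k)).re := by
  split_ifs with hw
  · subst hw; simp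
  · have h := norm_sum_range_pow_add_le hw1 hw N S
    have := Complex.abs_re_le_norm (∑ k ∈ range S, w ^ (N + k))
    have := neg_abs_le (∑ k ∈ range S, w ^ (N + k)).re
    linarith

/-- **Mean-square lower bound for power sums on the unit circle**: for `u_i` of modulus one
(`i ∈ I`), `∑_{k<S} ‖∑_{i∈I} u_i^{N+k}‖² ≥ |I|·S - B` with `B` independent of `N` and `S`.
[folklore] -/
theorem card_mul_sub_le_sum_normSq {ι : Type*} (I : Finset ι) (u : ι → ℂ)
    (hu : ∀ i ∈ I, ‖u i‖ = 1) (N S : ℕ) :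
    (I.card : ℝ) * S -
        ∑ i ∈ I, ∑ j ∈ I, (if u i * (starRingEnd ℂ) (u j) = 1 then (0 : ℝ)
          else 2 / ‖u i * (starRingEnd ℂ) (u j) - 1‖) ≤
      ∑ k ∈ range S, ‖∑ i ∈ I, u i ^ (N + k)‖ ^ 2 := by
  -- the window sum of squares as the real part of a triple sum
  have hw1 : ∀ i ∈ I, ∀ j ∈ I, ‖u i * (starRingEnd ℂ) (u j)‖ = 1 := fun i hi j hj => by
    rw [norm_mul, Complex.norm_conj, hu i hi, hu j hj, one_mul]
  have key : (∑ k ∈ range S, ‖∑ i ∈ I, u i ^ (N + k)‖ ^ 2 : ℝ) =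
      (∑ i ∈ I, ∑ j ∈ I, ∑ k ∈ range S, (u i * (starRingEnd ℂ) (u j)) ^ (N + k)).re := by
    have : ((∑ k ∈ range S, ‖∑ i ∈ I, u i ^ (N + k)‖ ^ 2 : ℝ) : ℂ) =
        ∑ i ∈ I, ∑ j ∈ I, ∑ k ∈ range S, (u i * (starRingEnd ℂ) (u j)) ^ (N + k) := by
      rw [Complex.ofReal_sum]
      simp_rw [normSq_sum_pow_eq]
      rw [sum_comm]
      refine sum_congr rfl fun i _ => ?_
      rw [sum_comm]
    rw [← this, Complex.ofReal_re]
  rw [key, Complex.re_sum]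
  -- termwise lower bounds
  have hterm : ∀ i ∈ I, ∀ j ∈ I,
      (if i = j then (S : ℝ) else 0) -
          (if u i * (starRingEnd ℂ) (u j) = 1 then (0 : ℝ)
            else 2 / ‖u i * (starRingEnd ℂ) (u j) - 1‖) ≤
        (∑ k ∈ range S, (u i * (starRingEnd ℂ) (u j)) ^ (N + k)).re := by
    intro i hi j hj
    have h := re_sum_range_pow_add_ge (hw1 i hi j hj) N S
    by_cases hij : i = j
    · subst hij
      have h1 : u i * (starRingEnd ℂ) (u i) = 1 := by
        rw [Complex.mul_conj, Complex.normSq_eq_norm_sq, hu i hi]; simp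
      rw [if_pos rfl, if_pos h1]
      rw [if_pos h1] at h
      linarith
    · rw [if_neg hij]
      split_ifs at h ⊢ with h1
      · have : (0 : ℝ) ≤ S := Nat.cast_nonneg S
        linarith
      · linarith
  have hsum : ∑ i ∈ I, ∑ j ∈ I, ((if i = j then (S : ℝ) else 0) -
      (if u i * (starRingEnd ℂ) (u j) = 1 then (0 : ℝ)
        else 2 / ‖u i * (starRingEnd ℂ) (u j) - 1‖)) ≤
      ∑ i ∈ I, (∑ j ∈ I, ∑ k ∈ range S, (u i * (starRingEnd ℂ) (u j)) ^ (N + k)).re :=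
    sum_le_sum fun i hi => by
      rw [Complex.re_sum]
      exact sum_le_sum fun j hj => hterm i hi j hj
  refine le_trans (le_of_eq ?_) hsum
  simp_rw [sum_sub_distrib]
  congr 1
  rw [sum_congr rfl fun i hi => sum_ite_eq I i (fun _ => (S : ℝ))]
  rw [sum_congr rfl fun i hi => if_pos hi, sum_const, nsmul_eq_mul]

/-- From a lower bound on a window average one gets one good exponent in every window. [folklore] -/
theorem exists_normSq_ge {ι : Type*} (I : Finset ι) (hI : I.Nonempty) (u : ι → ℂ)
    (hu : ∀ i ∈ I, ‖u i‖ = 1) :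
    ∃ S : ℕ, ∀ N : ℕ, ∃ k < S, (1 / 2 : ℝ) ≤ ‖∑ i ∈ I, u i ^ (N + k)‖ := by
  set B : ℝ := ∑ i ∈ I, ∑ j ∈ I, (if u i * (starRingEnd ℂ) (u j) = 1 then (0 : ℝ)
          else 2 / ‖u i * (starRingEnd ℂ) (u j) - 1‖) with hB
  have hB0 : 0 ≤ B := sum_nonneg fun i _ => sum_nonneg fun j _ => by
    split_ifs
    · exact le_rfl
    · exact div_nonneg zero_le_two (norm_nonneg _)
  set S : ℕ := ⌈2 * B⌉₊ + 1 with hS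
  have hS1 : (1 : ℝ) ≤ S := by rw [hS]; exact_mod_cast Nat.le_add_left 1 _
  have hSB : 2 * B ≤ S := by
    rw [hS, Nat.cast_add, Nat.cast_one]
    exact (Nat.le_ceil _).trans (le_add_of_nonneg_right zero_le_one)
  have hcard : (1 : ℝ) ≤ I.card := by exact_mod_cast hI.card_pos
  refine ⟨S, fun N => ?_⟩
  have hms := card_mul_sub_le_sum_normSq I u hu N S
  rw [← hB] at hms
  -- some term of the window is at least the average
  have hex : ∃ k ∈ range S, ((I.card : ℝ) * S - B) / S ≤ ‖∑ i ∈ I, u i ^ (N + k)‖ ^ 2 := by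
    apply exists_le_of_sum_le (nonempty_range_iff.2 (by rw [hS]; omega))
    rw [sum_const, card_range, nsmul_eq_mul, mul_div_cancel₀ _ (by positivity)]
    exact hms
  obtain ⟨k, hk, hle⟩ := hex
  refine ⟨k, mem_range.1 hk, ?_⟩
  have hhalf : (1 / 2 : ℝ) ≤ ((I.card : ℝ) * S - B) / S := by
    rw [le_div_iff₀ (by positivity)]
    nlinarith
  have h4 : (1 / 4 : ℝ) < ‖∑ i ∈ I, u i ^ (N + k)‖ ^ 2 := by linarith
  by_contra hlt
  push Not at hlt
  have h0 := norm_nonneg (∑ i ∈ I, u i ^ (N + k))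
  nlinarith

/-- **Power-sum lemma** (the analytic kernel of Stichtenoth Lemma 5.2.5, in elementary form): if
complex numbers `β₁, …, βₙ` satisfy `‖∑ᵢ βᵢ^s‖ ≤ C ρ^s` for all `s ≥ 1`, then `|βᵢ| ≤ ρ` for every
`i`. (The book argues with the radius of convergence of `∑ᵢ βᵢt/(1 - βᵢt)`; here: the `βᵢ` of
maximal modulus `R` have normalised power sums of mean square `≥ 1`, so infinitely often
`‖∑ βᵢ^s‖ ≥ R^s/2 - n R₂^s` with `R₂ < R`, forcing `R ≤ ρ`.) [cite: Stichtenoth2009, Lemma 5.2.5] -/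
theorem norm_le_of_norm_sum_pow_le {n : ℕ} (β : Fin n → ℂ) {ρ : ℝ} (hρ : 0 < ρ) (C : ℝ)
    (h : ∀ s : ℕ, 0 < s → ‖∑ i, β i ^ s‖ ≤ C * ρ ^ s) (i₀ : Fin n) : ‖β i₀‖ ≤ ρ := by
  by_contra hlt
  push Not at hlt
  -- the maximal modulus `R` and the set `I` of indices attaining it
  set R : ℝ := univ.sup' ⟨i₀, mem_univ _⟩ fun i => ‖β i‖ with hR
  have hRi : ∀ i, ‖β i‖ ≤ R := fun i => le_sup' (fun i => ‖β i‖) (mem_univ i)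
  have hρR : ρ < R := hlt.trans_le (hRi i₀)
  have hR0 : 0 < R := hρ.trans hρR
  set I : Finset (Fin n) := univ.filter fun i => ‖β i‖ = R with hI
  have hIne : I.Nonempty := by
    obtain ⟨i, -, hi⟩ := exists_mem_eq_sup' (⟨i₀, mem_univ _⟩ : (univ : Finset (Fin n)).Nonempty)
      fun i => ‖β i‖
    exact ⟨i, mem_filter.2 ⟨mem_univ _, hi.symm⟩⟩
  -- the second largest modulus `R₂ < R`
  set R₂ : ℝ := univ.sup' ⟨i₀, mem_univ _⟩ fun i => if ‖β i‖ < R then ‖β i‖ else 0 with hR₂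
  have hR₂R : R₂ < R := by
    rw [hR₂, sup'_lt_iff]
    intro i _
    split_ifs with h'
    · exact h'
    · exact hR0
  have hR₂0 : 0 ≤ R₂ := by
    refine le_trans ?_ (le_sup' (fun i => if ‖β i‖ < R then ‖β i‖ else 0) (mem_univ i₀))
    split_ifs
    · exact norm_nonneg _
    · exact le_rfl
  have hJ : ∀ i ∈ univ.filter (fun i => ¬ ‖β i‖ = R), ‖β i‖ ≤ R₂ := by
    intro i hi
    have hne : ‖β i‖ ≠ R := (mem_filter.1 hi).2
    have hlt' : ‖β i‖ < R := lt_of_le_of_ne (hRi i) hne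
    refine le_trans ?_ (le_sup' (fun i => if ‖β i‖ < R then ‖β i‖ else 0) (mem_univ i))
    simp [hlt']
  -- the normalised top roots `u i = β i / R`, of modulus one on `I`
  set u : Fin n → ℂ := fun i => β i / R with hu
  have hu1 : ∀ i ∈ I, ‖u i‖ = 1 := by
    intro i hi
    have hiR : ‖β i‖ = R := (mem_filter.1 hi).2
    simp only [hu, norm_div, Complex.norm_real, Real.norm_eq_abs, abs_of_pos hR0, hiR,
      div_self hR0.ne']
  have hβu : ∀ i ∈ I, ∀ s : ℕ, β i ^ s = (R : ℂ) ^ s * u i ^ s := by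
    intro i _ s
    rw [← mul_pow, hu]
    simp only
    rw [mul_div_cancel₀ _ (by exact_mod_cast hR0.ne')]
  -- one good exponent in every window of length `S`
  obtain ⟨S, hS⟩ := exists_normSq_ge I hIne u hu1
  -- geometric decay of the two error terms
  have hlim1 : ∀ᶠ s : ℕ in atTop, C * (ρ / R) ^ s < 1 / 8 := by
    have ht : Tendsto (fun s : ℕ => C * (ρ / R) ^ s) atTop (𝓝 (C * 0)) :=
      (tendsto_pow_atTop_nhds_zero_of_lt_one (div_nonneg hρ.le hR0.le)
        ((div_lt_one hR0).2 hρR)).const_mul C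
    rw [mul_zero] at ht
    exact ht.eventually (gt_mem_nhds (by norm_num))
  have hlim2 : ∀ᶠ s : ℕ in atTop, (n : ℝ) * (R₂ / R) ^ s < 1 / 8 := by
    have ht : Tendsto (fun s : ℕ => (n : ℝ) * (R₂ / R) ^ s) atTop (𝓝 ((n : ℝ) * 0)) :=
      (tendsto_pow_atTop_nhds_zero_of_lt_one (div_nonneg hR₂0 hR0.le)
        ((div_lt_one hR0).2 hR₂R)).const_mul (n : ℝ)
    rw [mul_zero] at ht
    exact ht.eventually (gt_mem_nhds (by norm_num))
  obtain ⟨N, hN⟩ := eventually_atTop.1 (hlim1.and hlim2)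
  obtain ⟨k, -, hk⟩ := hS (N + 1)
  set s : ℕ := N + 1 + k with hs
  have hsN : N ≤ s := by omega
  have hs0 : 0 < s := by omega
  obtain ⟨h1, h2⟩ := hN s hsN
  -- lower bound for the full power sum at the good exponent
  have hsplit : ∑ i, β i ^ s = ∑ i ∈ I, β i ^ s +
      ∑ i ∈ univ.filter (fun i => ¬ ‖β i‖ = R), β i ^ s :=
    (sum_filter_add_sum_filter_not univ (fun i => ‖β i‖ = R) fun i => β i ^ s).symm
  have htop : ‖∑ i ∈ I, β i ^ s‖ = R ^ s * ‖∑ i ∈ I, u i ^ s‖ := by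
    rw [sum_congr rfl fun i hi => hβu i hi s, ← mul_sum, norm_mul, norm_pow, Complex.norm_real,
      Real.norm_eq_abs, abs_of_pos hR0]
  have hrest : ‖∑ i ∈ univ.filter (fun i => ¬ ‖β i‖ = R), β i ^ s‖ ≤ n * R₂ ^ s := by
    refine (norm_sum_le _ _).trans ?_
    calc ∑ i ∈ univ.filter (fun i => ¬ ‖β i‖ = R), ‖β i ^ s‖
        ≤ ∑ i ∈ univ.filter (fun i => ¬ ‖β i‖ = R), R₂ ^ s :=
          sum_le_sum fun i hi => by
            rw [norm_pow]
            exact pow_le_pow_left₀ (norm_nonneg _) (hJ i hi) s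
      _ = (univ.filter (fun i => ¬ ‖β i‖ = R)).card * R₂ ^ s := by
          rw [sum_const, nsmul_eq_mul]
      _ ≤ n * R₂ ^ s := by
          gcongr
          exact_mod_cast (card_filter_le _ _).trans (card_fin n).le
  have hlow : R ^ s / 2 - n * R₂ ^ s ≤ C * ρ ^ s := by
    refine le_trans ?_ (h s hs0)
    rw [hsplit]
    refine le_trans ?_ (norm_sub_le_norm_add _ _) -- ‖a‖ - ‖b‖ ≤ ‖a + b‖
    rw [htop]
    have hRs : 0 < R ^ s := pow_pos hR0 s
    nlinarith
  -- divide by `R^s` and conclude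
  have hRs : 0 < R ^ s := pow_pos hR0 s
  have e1 : C * ρ ^ s = (C * (ρ / R) ^ s) * R ^ s := by
    rw [div_pow, mul_assoc, div_mul_cancel₀ _ hRs.ne']
  have e2 : (n : ℝ) * R₂ ^ s = ((n : ℝ) * (R₂ / R) ^ s) * R ^ s := by
    rw [div_pow, mul_assoc, div_mul_cancel₀ _ hRs.ne']
  rw [e1, e2] at hlow
  nlinarith

end PowerSum

/-! ### Lemma 5.2.5: Hasse–Weil from the estimate `|N_r - (q^r + 1)| ≤ c q^{r/2}` -/

section Reduction

open Polynomial LPolynomial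

variable {K : Type u} {F : Type v} [Field K] [Fintype K] [Field F] [Algebra K F]
  [IsAlgFunctionField K F] [IsIntegrallyClosedIn K F]

/-- A polynomial whose power series is the `L`-polynomial has degree `2g` (Thm. 5.1.15 (a),
`exists_lPolynomial`, and injectivity of `ℤ[t] → ℤ⟦t⟧`). [cite: Stichtenoth2009, Thm. 5.1.15(a)] -/
theorem natDegree_eq_of_coe_eq_lSeries (L : ℤ[X]) (hL : (L : PowerSeries ℤ) = lSeries K F) :
    L.natDegree = 2 * genus K F := by
  obtain ⟨L', h', hL'⟩ := exists_lPolynomial (K := K) (F := F)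
  rw [Polynomial.coe_inj.1 (hL.trans hL'.symm), h']

omit [IsIntegrallyClosedIn K F] in
/-- Its constant coefficient is `a₀ = 1` (Thm. 5.1.15 (d)). [cite: Stichtenoth2009, Thm. 5.1.15(d)] -/
theorem coeff_zero_of_coe_eq_lSeries (L : ℤ[X]) (hL : (L : PowerSeries ℤ) = lSeries K F) :
    L.coeff 0 = 1 := by
  rw [← Polynomial.coeff_coe, hL, PowerSeries.coeff_zero_eq_constantCoeff, constantCoeff_lSeries]

/-- Its leading coefficient is `a_{2g} = q^g` (Thm. 5.1.15 (d), `coeff_two_mul_genus_lSeries` with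
F. K. Schmidt's `∂ = 1`, `minPosDegree_eq_one_holds`). [cite: Stichtenoth2009, Thm. 5.1.15(d)] -/
theorem coeff_two_mul_genus_of_coe_eq_lSeries (L : ℤ[X])
    (hL : (L : PowerSeries ℤ) = lSeries K F) :
    L.coeff (2 * genus K F) = (Fintype.card K : ℤ) ^ genus K F := by
  rw [← Polynomial.coeff_coe, hL]
  exact coeff_two_mul_genus_lSeries (minPosDegree_eq_one_holds K F)

/-- **Stichtenoth Lemma 5.2.5 with Lemma 5.2.4 built in** (pointwise form): if for some `k ≥ 1` the
point counts satisfy `|N_{ks} - (q^{ks} + 1)| ≤ c q^{ks/2}` for all `s ≥ 1`, then every complex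
root `z` of a polynomial `L ∈ ℤ[t]` with `L(t) = L_F(t)` has `|z|⁻¹ = q^{1/2}`, i.e. the reciprocal
roots `αᵢ` of the `L`-polynomial all have absolute value `q^{1/2}`.
[cite: Stichtenoth2009, Lemma 5.2.4 and Lemma 5.2.5] -/
theorem norm_inv_eq_sqrt_of_abs_pointCount_sub_le {k : ℕ} (hk : 0 < k) (c : ℝ)
    (hN : ∀ s : ℕ, 0 < s →
      |(pointCount K F (k * s) : ℝ) - ((Fintype.card K : ℝ) ^ (k * s) + 1)| ≤
        c * Real.sqrt (Fintype.card K) ^ (k * s))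
    (L : ℤ[X]) (hL : (L : PowerSeries ℤ) = lSeries K F) (z : ℂ)
    (hz : (L.map (Int.castRingHom ℂ)).IsRoot z) :
    ‖z‖⁻¹ = Real.sqrt (Fintype.card K) := by
  set q : ℕ := Fintype.card K with hq
  set g : ℕ := genus K F with hg
  set Lc : ℂ[X] := L.map (Int.castRingHom ℂ) with hLc
  have hq0 : (0 : ℝ) < q := by rw [hq]; exact_mod_cast Fintype.card_pos
  have hsq0 : 0 < Real.sqrt q := Real.sqrt_pos.2 hq0
  have hdeg : L.natDegree = 2 * g := natDegree_eq_of_coe_eq_lSeries L hL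
  have hdegC : Lc.natDegree = 2 * g := by
    rw [hLc, natDegree_map_eq_of_injective (RingHom.injective_int _), hdeg]
  -- enumerate the `2g` complex roots `e i`; they are nonzero
  obtain ⟨e, he⟩ := exists_fin_enum Lc.roots ((card_roots_map_eq_natDegree L).trans hdeg)
  have hmem : ∀ i, e i ∈ Lc.roots := fun i => by
    rw [← he]; exact Multiset.mem_map_of_mem _ (Finset.mem_univ_val i)
  have hL0 : Lc.coeff 0 = 1 := by
    rw [hLc, coeff_map, coeff_zero_of_coe_eq_lSeries L hL, map_one]
  have hLc0 : Lc ≠ 0 := fun h => by rw [h, coeff_zero] at hL0; exact zero_ne_one hL0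
  have he0 : ∀ i, e i ≠ 0 := fun i => ne_zero_of_mem_roots_of_coeff_zero_eq_one hL0 (hmem i)
  -- `a_{2g} = q^g` and `a₀ = 1` give `q^g ∏ eᵢ = 1`
  have hlead : Lc.leadingCoeff = (q : ℂ) ^ g := by
    rw [leadingCoeff, hdegC, hLc, coeff_map, coeff_two_mul_genus_of_coe_eq_lSeries L hL]
    simp [hq, hg]
  have hprod : (q : ℂ) ^ g * ∏ i, e i = 1 := by
    have h := (IsAlgClosed.splits Lc).coeff_zero_eq_leadingCoeff_mul_prod_roots
    rw [hL0, hdegC, hlead, pow_mul, neg_one_sq, one_pow, one_mul, ← he] at h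
    rw [h, Finset.prod_eq_multiset_prod]
  -- the reciprocal roots `αᵢ`
  set α : Fin (2 * g) → ℂ := fun i => (e i)⁻¹ with hα
  have hα0 : ∀ i, α i ≠ 0 := fun i => inv_ne_zero (he0 i)
  have hprodα : ∏ i, ‖α i‖ = Real.sqrt q ^ (2 * g) := by
    have h1 : ∏ i, α i = (q : ℂ) ^ g := by
      rw [eq_inv_of_mul_eq_one_left hprod, ← Finset.prod_inv_distrib]
    have h2 : ‖∏ i, α i‖ = (q : ℝ) ^ g := by
      rw [h1, norm_pow]; simp
    rw [← norm_prod, h2, pow_mul, Real.sq_sqrt hq0.le]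
  -- Cor. 5.1.16 turns the hypothesis into a bound for the power sums of `βᵢ = αᵢ^k`
  have hps : ∀ s : ℕ, 0 < s → ‖∑ i, (α i ^ k) ^ s‖ ≤ c * (Real.sqrt q ^ k) ^ s := by
    intro s hs
    have hr : 0 < k * s := Nat.mul_pos hk hs
    have h1 := pointCount_eq_of_coe_eq_lSeries L hL hr
    have hsum : (Lc.roots.map fun z => z⁻¹ ^ (k * s)).sum = ∑ i, (α i ^ k) ^ s := by
      rw [← he, Multiset.map_map, Finset.sum_eq_multiset_sum]
      simp only [Function.comp_def, hα, pow_mul]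
    have h2 : (∑ i, (α i ^ k) ^ s : ℂ) =
        (((q : ℝ) ^ (k * s) + 1 - (pointCount K F (k * s) : ℝ) : ℝ) : ℂ) := by
      rw [← hsum, ← hLc] at *
      push_cast
      rw [h1, hq]
      ring
    rw [h2, Complex.norm_real, Real.norm_eq_abs, abs_sub_comm, ← pow_mul]
    exact hN s hs
  have hle : ∀ i, ‖α i‖ ≤ Real.sqrt q := by
    intro i
    have h := PowerSum.norm_le_of_norm_sum_pow_le (fun i => α i ^ k) (pow_pos hsq0 k) c hps i
    rw [norm_pow] at h
    exact le_of_pow_le_pow_left₀ hk.ne' hsq0.le h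
  -- `∏ |αᵢ| = q^g` forces equality everywhere
  have heq : ∀ i, ‖α i‖ = Real.sqrt q := by
    by_contra hne
    push Not at hne
    obtain ⟨j, hj⟩ := hne
    have hlt : ‖α j‖ < Real.sqrt q := lt_of_le_of_ne (hle j) hj
    have h : ∏ i, ‖α i‖ < ∏ _i : Fin (2 * g), Real.sqrt q :=
      Finset.prod_lt_prod (fun i _ => norm_pos_iff.2 (hα0 i)) (fun i _ => hle i)
        ⟨j, Finset.mem_univ _, hlt⟩
    rw [hprodα, Finset.prod_const, Finset.card_univ, Fintype.card_fin] at h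
    exact lt_irrefl _ h
  -- the given root is one of the `e i`
  obtain ⟨i, hi⟩ : ∃ i, e i = z := by
    have h : z ∈ Finset.univ.val.map e := by rw [he]; exact (mem_roots hLc0).2 hz
    simpa using h
  rw [← hi, ← norm_inv]
  exact heq i

end Reduction

/-- **The Hasse–Weil theorem from the point-count estimate along an arithmetic progression**
(Stichtenoth Lemma 5.2.5 + Lemma 5.2.4): for a function field `F/𝔽_q` (finite constant field), if
for some `k ≥ 1` and some real `c` the numbers `N_r = ∑_{d ∣ r} d · B_d` satisfy
`|N_{ks} - (q^{ks} + 1)| ≤ c · q^{ks/2}` for all `s ≥ 1`, then the named fact `hasseWeil 𝔽_q F`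
(Thm. 5.2.1: `|αᵢ| = q^{1/2}` for the reciprocal roots of `L_F`) holds. The remaining content of
Thm. 5.2.1 is thus the two-sided estimate (5.23)/(5.24) for a suitable constant field extension,
Prop. 5.2.6–5.2.8. [cite: Stichtenoth2009, Lemma 5.2.4, Lemma 5.2.5] -/
theorem hasseWeil_of_abs_pointCount_sub_le {K : Type u} {F : Type v} [Field K] [Fintype K]
    [Field F] [Algebra K F] {k : ℕ} (hk : 0 < k) (c : ℝ)
    (hN : ∀ s : ℕ, 0 < s →
      |(pointCount K F (k * s) : ℝ) - ((Fintype.card K : ℝ) ^ (k * s) + 1)| ≤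
        c * Real.sqrt (Fintype.card K) ^ (k * s)) :
    hasseWeil K F := by
  intro _ _ L hL z hz
  exact norm_inv_eq_sqrt_of_abs_pointCount_sub_le hk c hN L hL z hz

end Literature.NumberTheory.DiophantineGeometry.AlgFunctionField

end
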